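import Summits.ResolutionOfSingularities.ResolutionOfSingularities.Theorems.FrobeniusLadderFRationalResolutionTraceIdealBasics
import HarnessLib

/-!
# Crux `FrobeniusLadder.FRationalResolution` (stmt-ResolutionOfSingularities-15317), line `redirect`,
# stub `stub_diagonalizableQuotientResolution` — FINITELY MANY DIVISORIAL CLASSES ⇒ THE SET `𝒯` OF TRACE IDEALS IS FINITE AND EXPLICIT
# (item (α′) of MEMO-15317-leafhand2-g17 §3 reduced to «a finite list of representatives of the nonzero divisorial ideals up to isomorphism»)

The capstone `…IntrinsicRecipe.hloc_of_traceIdealCentre_then_singularPoints` (p839630) takes `hfin : 𝒯 finite`, `𝒯 = {τ(I) : I nonzero divisorial}`, and the fan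
facts are about the EXPLICIT ideal `∏_{T ∈ 𝒯} T`. Since `τ` is an isomorphism invariant (`…TraceIdealBasics.traceIdeal_eq_of_linearEquiv`), both are controlled
by a finite list `S` of ideals representing the nonzero divisorial ideals up to `A`-linear isomorphism (for the toric germ: the semi-invariant ideals `C_w`,
`w ∈ Cl = ℤ/r`):

* `traceIdeals_subset_image` — if every `I` with `P I` is isomorphic to a member of `S`, then `𝒯_P ⊆ τ '' S`; hence ★ `traceIdeals_finite_of_representatives`;
* ★★ `traceIdeals_eq_image` — if moreover every member of `S` satisfies `P`, then `𝒯_P = τ '' S` (so `∏_{T ∈ 𝒯_P} T` is the product of the DISTINCT `τ(J)`, `J ∈ S`: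
  `prod_traceIdeals_eq_of_representatives`).

Honest label: general commutative algebra toward ONE leaf stub (no stub, crux or summit closed); what remains of (α′) is to produce `S` for `F[[P]]` (every nonzero
divisorial ideal `≅ C_w`) and to compute `τ(C_w) = C_w·C_{−w}`. No definitions, no named facts, no sorry. [folklore; cite: Matsumura1987, §11]
-/

-- single-problem summit: the doubled namespace component is forced
set_option linter.dupNamespace false

namespace Summit.ResolutionOfSingularities.ResolutionOfSingularities.Theorems.FRationalResolution.TraceIdealRepresentatives

open TraceIdealBasics

universe u

/-- `𝒯_P ⊆ τ '' S` when `S` represents the class `P` up to isomorphism. [folklore] -/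
theorem traceIdeals_subset_image {A : Type u} [CommRing A] (P : Ideal A → Prop) (S : Finset (Ideal A))
    (hrep : ∀ I : Ideal A, P I → ∃ J ∈ S, Nonempty (I ≃ₗ[A] J)) :
    {T : Ideal A | ∃ I : Ideal A, P I ∧ T = ⨆ φ : I →ₗ[A] A, LinearMap.range φ} ⊆
      (fun J : Ideal A => (⨆ φ : J →ₗ[A] A, LinearMap.range φ : Ideal A)) '' (S : Set (Ideal A)) := by
  rintro T ⟨I, hI, rfl⟩
  obtain ⟨J, hJ, ⟨e⟩⟩ := hrep I hI
  exact ⟨J, hJ, (traceIdeal_eq_of_linearEquiv e).symm⟩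

/-- ★ **Finitely many classes ⇒ finitely many trace ideals.** [folklore] -/
theorem traceIdeals_finite_of_representatives {A : Type u} [CommRing A] (P : Ideal A → Prop) (S : Finset (Ideal A))
    (hrep : ∀ I : Ideal A, P I → ∃ J ∈ S, Nonempty (I ≃ₗ[A] J)) :
    Set.Finite {T : Ideal A | ∃ I : Ideal A, P I ∧ T = ⨆ φ : I →ₗ[A] A, LinearMap.range φ} :=
  ((S.finite_toSet).image _).subset (traceIdeals_subset_image P S hrep)

/-- ★★ **`𝒯_P = τ '' S`** when `S ⊆ P` represents `P` up to isomorphism. [folklore] -/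
theorem traceIdeals_eq_image {A : Type u} [CommRing A] (P : Ideal A → Prop) (S : Finset (Ideal A))
    (hrep : ∀ I : Ideal A, P I → ∃ J ∈ S, Nonempty (I ≃ₗ[A] J)) (hS : ∀ J ∈ S, P J) :
    {T : Ideal A | ∃ I : Ideal A, P I ∧ T = ⨆ φ : I →ₗ[A] A, LinearMap.range φ} =
      (fun J : Ideal A => (⨆ φ : J →ₗ[A] A, LinearMap.range φ : Ideal A)) '' (S : Set (Ideal A)) := by
  refine Set.Subset.antisymm (traceIdeals_subset_image P S hrep) ?_
  rintro T ⟨J, hJ, rfl⟩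
  exact ⟨J, hS J hJ, rfl⟩

/-- **The intrinsic centre is the product of the DISTINCT trace ideals of the representatives**: with `hfin` the finiteness witness of
`traceIdeals_finite_of_representatives`, `∏_{T ∈ 𝒯_P} T = ∏_{T ∈ τ(S)} T`. [folklore] -/
theorem prod_traceIdeals_eq_of_representatives {A : Type u} [CommRing A] (P : Ideal A → Prop) (S : Finset (Ideal A))
    (hrep : ∀ I : Ideal A, P I → ∃ J ∈ S, Nonempty (I ≃ₗ[A] J)) (hS : ∀ J ∈ S, P J)
    (hfin : Set.Finite {T : Ideal A | ∃ I : Ideal A, P I ∧ T = ⨆ φ : I →ₗ[A] A, LinearMap.range φ}) :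
    ∏ T ∈ hfin.toFinset, T = ∏ T ∈ S.image (fun J : Ideal A => (⨆ φ : J →ₗ[A] A, LinearMap.range φ : Ideal A)), T := by
  classical
  congr 1
  ext T
  rw [Set.Finite.mem_toFinset, traceIdeals_eq_image P S hrep hS, Finset.mem_image, Set.mem_image]
  simp only [Finset.mem_coe]

/-- The same statements for the class `P` = «nonzero divisorial» of `…DivisorialIdealsCharacteristic` / `…IntrinsicRecipe`, spelled out: a finite list `S` of
nonzero divisorial ideals such that every nonzero divisorial ideal is isomorphic to a member of `S` yields the `hfin` of
`…IntrinsicRecipe.hloc_of_traceIdealCentre_then_singularPoints` and identifies `𝔞_tot` with `∏_{T ∈ τ(S)} T`. [folklore; cite: Matsumura1987, §11] -/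
theorem hfin_and_prod_eq_of_divisorial_representatives {A : Type u} [CommRing A] (S : Finset (Ideal A))
    (hrep : ∀ I : Ideal A, (I ≠ ⊥ ∧ ∀ x : A, (∀ a b : A, (∀ y ∈ I, b * y ∈ Ideal.span ({a} : Set A)) → b * x ∈ Ideal.span ({a} : Set A)) → x ∈ I) →
      ∃ J ∈ S, Nonempty (I ≃ₗ[A] J))
    (hS : ∀ J ∈ S, J ≠ ⊥ ∧ ∀ x : A, (∀ a b : A, (∀ y ∈ J, b * y ∈ Ideal.span ({a} : Set A)) → b * x ∈ Ideal.span ({a} : Set A)) → x ∈ J) :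
    ∃ hfin : Set.Finite {T : Ideal A | ∃ I : Ideal A,
        (I ≠ ⊥ ∧ ∀ x : A, (∀ a b : A, (∀ y ∈ I, b * y ∈ Ideal.span ({a} : Set A)) → b * x ∈ Ideal.span ({a} : Set A)) → x ∈ I) ∧
        T = ⨆ φ : I →ₗ[A] A, LinearMap.range φ},
      ∏ T ∈ hfin.toFinset, T = ∏ T ∈ S.image (fun J : Ideal A => (⨆ φ : J →ₗ[A] A, LinearMap.range φ : Ideal A)), T :=
  ⟨traceIdeals_finite_of_representatives _ S hrep, prod_traceIdeals_eq_of_representatives _ S hrep hS _⟩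

end Summit.ResolutionOfSingularities.ResolutionOfSingularities.Theorems.FRationalResolution.TraceIdealRepresentatives
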